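import Summits.ABC.ABC.Theorems.PadicPrincipalCoreST86TheoremA
import Summits.ABC.StewartYu.KappaDoorEpsShape
import Summits.ABC.StewartYu.PrimePadicSocketOdd
import HarnessLib

/-!
# Cell abc-stewartyu: the abc consequences of Theorem A — `log c ≪ rad^15` (M1) and
# `log c ≪_ε rad^{3+ε}` (M1⁺(3)) — modulo WP-M only

`Summits/ABC/StewartYu/PadicCW77EpsShapeThree.lean` — cell `abc-stewartyu` (seat p3; theorems
only).  From `theoremAShapeLe_one_holds` (Theorem A with `c₁ = 2⁷⁰`, `c₂ = 1`) and the principal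
generators of WP-M (hypothesis `hM`, = `Summit.ABC.StewartYu.PrincipalLattice.exists_principal_generators`
once `PadicLogFormsPrincipalReduction.lean` lands):

* `epsShapeBoundThree_of_WPM : WPM-body → Literature.Barriers.ABC.EpsShapeBoundThree` (κ-door with
  κ = c₂ + 2 = 3: `KappaDoor.epsShapeBoundThree_of_principal_core`);
* `stewartTijdeman1986_of_WPM : WPM-body → Literature.Barriers.ABC.stewartTijdeman1986_upperBound`
  (glue `primePadicBoundAt_odd_of_principal` + odd-prime socket with θ = 15 ≥ κ + 3).

Everything is [folklore] assembly.
-/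

noncomputable section

open Finset
open Literature.NumberTheory.Transcendental
open Literature.NumberTheory.Transcendental.PadicCW77
open Literature.Barriers.ABC

namespace Summit.ABC.StewartYu

/-- **M1⁺(3): `log c ≪_ε rad(abc)^{3+ε}`** from WP-M's principal generators. [folklore] -/
theorem epsShapeBoundThree_of_WPM
    (hM : ∀ (p : ℕ), p.Prime → p ≠ 2 → ∀ (m : ℕ) (q : Fin m → ℕ),
      (∀ i, (q i).Prime) → Function.Injective q → (∀ i, q i ≠ p) →
      ∀ (e : Fin m → ℤ), e ≠ 0 → 1 ≤ padicValRat p (∏ i, (q i : ℚ) ^ e i - 1) →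
      ∃ (α : Fin m → ℚ) (e' : Fin m → ℤ),
        (∀ j, α j ≠ 0 ∧ 1 ≤ padicValRat p (α j - 1)) ∧
        (∀ μ : Fin m → ℤ, ∏ j, α j ^ μ j = 1 → μ = 0) ∧
        (∀ T : Finset (Fin m), T.Nonempty → ¬ IsSquare (∏ j ∈ T, α j)) ∧
        e' ≠ 0 ∧ ∏ i, (q i : ℚ) ^ e i = ∏ j, α j ^ e' j ∧
        (∏ j, Height.logHeight₁ (α j)) ≤ (m : ℝ) ^ (2 * m) * p * ∏ i, Real.log (q i) ∧
        (∀ j, (|e' j| : ℝ) ≤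
          (m : ℝ) ^ (2 * m) * p * (∏ i, Real.log (q i)) * (Finset.univ.sup fun i => (e i).natAbs)) ∧
        (∀ j, Real.log p ≤ 2 * Height.logHeight₁ (α j))) :
    EpsShapeBoundThree := by
  obtain ⟨C, r, c₁, c₂, hc₁, _hc₂, hc₂1, hC, hA⟩ := theoremAShapeLe_one_holds
  exact KappaDoor.epsShapeBoundThree_of_principal_core hM hc₁ hc₂1 hC hA

/-- **M1: `log c ≤ κ · rad(abc)^15`** (`stewartTijdeman1986_upperBound = BakerShapeBound 15 0`) from
WP-M's principal generators: glue (κ = c₂ + 2 ≤ 3, σ = 2) and the odd-prime socket with θ = 15.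
[folklore] -/
theorem stewartTijdeman1986_of_WPM
    (hM : ∀ (p : ℕ), p.Prime → p ≠ 2 → ∀ (m : ℕ) (q : Fin m → ℕ),
      (∀ i, (q i).Prime) → Function.Injective q → (∀ i, q i ≠ p) →
      ∀ (e : Fin m → ℤ), e ≠ 0 → 1 ≤ padicValRat p (∏ i, (q i : ℚ) ^ e i - 1) →
      ∃ (α : Fin m → ℚ) (e' : Fin m → ℤ),
        (∀ j, α j ≠ 0 ∧ 1 ≤ padicValRat p (α j - 1)) ∧
        (∀ μ : Fin m → ℤ, ∏ j, α j ^ μ j = 1 → μ = 0) ∧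
        (∀ T : Finset (Fin m), T.Nonempty → ¬ IsSquare (∏ j ∈ T, α j)) ∧
        e' ≠ 0 ∧ ∏ i, (q i : ℚ) ^ e i = ∏ j, α j ^ e' j ∧
        (∏ j, Height.logHeight₁ (α j)) ≤ (m : ℝ) ^ (2 * m) * p * ∏ i, Real.log (q i) ∧
        (∀ j, (|e' j| : ℝ) ≤
          (m : ℝ) ^ (2 * m) * p * (∏ i, Real.log (q i)) * (Finset.univ.sup fun i => (e i).natAbs)) ∧
        (∀ j, Real.log p ≤ 2 * Height.logHeight₁ (α j))) :
    stewartTijdeman1986_upperBound := by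
  obtain ⟨C, r, c₁, c₂, hc₁, hc₂, hc₂1, hC, hA⟩ := theoremAShapeLe_one_holds
  refine stewartTijdeman1986_of_oddPrime_logRadShape (K := 4704) (L := 32 * c₁) (κ := c₂ + 2) (σ := 2)
    (τ := 2) (τ₁ := 2) (by norm_num) (by linarith) (by linarith) (by norm_num) (by linarith) ?_
  intro p hp hp2 n q e hq hinj hqp he hne1
  exact primePadicBoundAt_odd_of_principal hM hc₁ hC hA hp hp2 n q e hq hinj hqp he hne1

end Summit.ABC.StewartYu

end
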